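/-
Copyright (c) 2026. All rights reserved.
Released under Apache 2.0 license as described in the file LICENSE.
-/
import Literature.AlgebraicGeometry.ComplexMultiplication.GaloisOcticSimpleCMFourfolds
import Literature.AlgebraicGeometry.Pohlmann1968.CMFieldLowDegreeHodgeConjectureVariety
import Literature.AlgebraicGeometry.Pohlmann1968.DegenerateCMTypesMultiquadraticCMFieldParity
import HarnessLib

/-!
# The Hodge conjecture for EVERY abelian variety with complex multiplication by a GALOIS octic CM field — simple or
# not — and for all its powers, unconditionally (`K ∈ {ℚ(ζ₁₅), ℚ(ζ₁₆), ℚ(ζ₂₀), ℚ(ζ₂₄)}`, cyclic, `ℤ/4 × ℤ/2`,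
# triquadratic, dihedral and quaternion octic CM fields Galois over `ℚ`)

Two tree theorems assembled.  (1) `GaloisOcticSimpleCMFourfolds` (B. Dodson [Dodson1984] §3.3.2 Theorem, the Galois
slice, with a classification-free proof): a SIMPLE abelian fourfold with complex multiplication by a CM field `K` of
degree `8` Galois over `ℚ` realises a NONDEGENERATE CM type, hence (Hazama–Murty; B. B. Gordon [Gordon1999HodgeAVSurvey]
5.13 (i), Thm. 6.4) `Bᵐ(Aⁿ) ⊗ ℂ = Dᵐ(Aⁿ) ⊗ ℂ` and the Hodge conjecture for every power —
`hodgeConjectureFor_pow_of_isSimple_of_isGalois_eight`.  (2) `CMFieldImprimitiveTypeDegreeLeTwelveHodgeConjecture` /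
`CMFieldLowDegreeHodgeConjectureVariety`: a NON-SIMPLE abelian variety with complex multiplication (through a CM type)
by a CM field of degree `≤ 12` satisfies `Bᵐ(Aⁿ) ⊗ ℂ = Dᵐ(Aⁿ) ⊗ ℂ` and the Hodge conjecture for every power (the
primitive sub-pair has degree `≤ 6` and is nondegenerate) — `hodgeConjectureFor_pow_of_not_isSimple_of_finrank_le_twelve`.
The dichotomy `A` simple / not simple is decided classically, so:

* §1 **`hodgeClassSpan_pow_eq_divisorClassesSpan_of_isGalois_eight`** — `K` a CM field of degree `8` Galois over `ℚ`,
  `Φ` ANY CM type, `(A, ι, θ)` ANY abelian variety of type `(K; Φ)` read on `H¹`: `Bᵐ(Aⁿ) ⊗ ℂ = Dᵐ(Aⁿ) ⊗ ℂ` for all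
  `n, m`; **`hodgeConjectureFor_pow_of_isGalois_eight`** — THE HODGE CONJECTURE FOR `Aⁿ`, EVERY `n`;
  **`hodgeConjectureFor_of_isGalois_eight`** (`A` itself, spelling `A.dim`); `hodgeClasses_algebraic_pow_of_isGalois_eight`;
  `not_exists_exceptional_pow_of_isGalois_eight` (no power of `A` carries an exceptional Hodge class);
  `isSimple_iff_isNondegenerate_of_isGalois_eight`, `isSimple_iff_cmTypeRank_eq_five_of_isGalois_eight`.
* §2 The four cyclotomic octic CM fields: `hodgeConjectureFor_pow_of_isCyclotomicExtension_fifteen` / `_sixteen` /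
  `_twenty` / `_twentyFour` — every abelian variety of CM type `(ℚ(ζₙ), Φ)`, `n ∈ {15, 16, 20, 24}`, satisfies the
  Hodge conjecture together with all its powers.
* §3 Addendum for multiquadratic CM fields of ANY degree `≥ 8` (seat p10 g37-#4's rank-`2` stabiliser):
  `Multiquadratic.not_isPrimitive_of_comp_mem_iff` (a non-trivial `g ∈ Aut(K)` with `Φg = Φ` makes `Φ` imprimitive —
  Shimura §8.2 Prop. 26), `Multiquadratic.not_isSimple_of_cmTypeRank_eq_two` (the varieties of a rank-`2` type are
  never simple).

HONEST SCOPE.  An assembly of tree theorems by excluded middle on `A.IsSimple`; non-Galois octic CM fields (where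
degenerate simple fourfolds exist: Mumford's example, `ℤ₂ × A₄` / `ℤ₂ × S₄`) are not covered.  THEOREMS ONLY: no
definition, no named fact, no instance, no `sorry`.

## References

* [Dodson1984] B. Dodson, Trans. AMS 283 (1984), §3.3.2 Theorem (p. 16) and its proof.
* [Gordon1999HodgeAVSurvey] B. B. Gordon, *A survey of the Hodge conjecture for abelian varieties*, 5.13 (i), Thm. 6.4,
  §9.3.
* [MoonenZarhin1999LowDim] B. Moonen, Yu. Zarhin, Math. Ann. 315 (1999), Thm. 0.1 (dimension `≤ 5`, non-simple case).
* [MoonenZarhin1995Duke] B. Moonen, Yu. Zarhin, Duke Math. J. 77 (1995), Thm. 2.4.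
* [Shimura1998] G. Shimura, *Abelian Varieties with Complex Multiplication and Modular Functions*, §8.2 Prop. 26.
* [Kubota1965] T. Kubota, Trans. AMS 118 (1965), §4 Lemma 2 (the rank).
* [vanGeemen1994HodgeAV] B. van Geemen (1994), Lemma 3.7 (isogeny invariance).

## Provenance

Lane `lit-hodgefound` (Track 2, Layer A5), seat `lit-hodgefound-p10` generation 37, row g37-#8; neighbours cited by
name, nothing restated: `GaloisOcticSimpleCMFourfolds` (`isNondegenerate_of_isSimple_of_isGalois_eight`,
`hodgeClassSpan_pow_eq_divisorClassesSpan_of_isSimple_of_isGalois_eight`, `hodgeConjectureFor_pow_of_isSimple_of_isGalois_eight`,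
`hodgeConjectureFor_of_isSimple_of_isGalois_eight`), `CMFieldImprimitiveTypeDegreeLeTwelveHodgeConjecture`
(`hodgeClassSpan_pow_eq_divisorClassesSpan_of_not_isPrimitive_of_finrank_le_twelve`,
`hodgeConjectureFor_pow_of_not_isSimple_of_finrank_le_twelve`), `CMFieldLowDegreeHodgeConjectureVariety`
(`hodgeConjectureFor_of_not_isSimple_of_finrank_le_twelve`), `NondegenerateCMTypeDivisorClasses`
(`IsNondegenerate.isPrimitive`), `SimpleIffPrimitiveCMType` (`isSimple_iff_isPrimitive`), `PrimitiveCMTypeSimple`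
(`isPrimitive_ringEquiv_complex_iff`), `DegenerateCMTypesMultiquadraticCMFieldParity`
(`exists_ne_one_stabilizer_of_cmTypeRank_eq_two`).
-/

open scoped Classical NumberField
open NumberField Module CategoryTheory CategoryTheory.Limits

namespace Literature.AlgebraicGeometry.Pohlmann1968

-- `open scoped`: the tree's action of `Aut(ℂ)` on `Hom(K, ℂ)` by composition is a scoped instance
open scoped Literature.NumberTheory.ComplexMultiplication
open Literature.NumberTheory.ComplexMultiplication (IsPrimitive)
open Literature.AlgebraicGeometry.Motives (CMType AbelianVariety)
open Literature.AlgebraicGeometry.HodgeTheory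
open Literature.AlgebraicGeometry.VanGeemen1994 (hodgeClassSpan)
open Literature.Barriers.HodgeConjecture (divisorClassesSpan)
open Literature.AlgebraicGeometry.ComplexMultiplication (IsCMTypeRealisation isSimple_iff_isPrimitive
  isPrimitive_ringEquiv_complex_iff)
open Literature.AlgebraicGeometry.ComplexMultiplication.GaloisOcticStabiliser.GaloisOctic
  (isNondegenerate_of_isSimple_of_isGalois_eight hodgeClassSpan_pow_eq_divisorClassesSpan_of_isSimple_of_isGalois_eight
    hodgeConjectureFor_pow_of_isSimple_of_isGalois_eight hodgeConjectureFor_of_isSimple_of_isGalois_eight)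

variable {K : Type} [Field K] [NumberField K] [IsCMField K]
  {A : AbelianVariety ℂ} {ι : 𝓞 K →+* End A} {θ : K →+* Module.End ℂ (complexBetti A.X 1)}

/-! ## §1 Galois octic CM fields: every realisation of every CM type -/

section GaloisOctic

variable [IsGalois ℚ K]

/-- **Galois octic CM fields: `A` simple ⟺ `Φ` nondegenerate** (⟹ Dodson 3.3.2, Galois slice; ⟸ Kubota: nondegenerate
⟹ primitive ⟹ simple, tree `IsNondegenerate.isPrimitive`, Shimura §8.2 Prop. 26). [cite: Dodson1984, §3.3.2 Theorem (p. 16)]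
[cite: Shimura1998, §8.2 Prop. 26] -/
theorem isSimple_iff_isNondegenerate_of_isGalois_eight (hK : Module.finrank ℚ K = 8) (Φ : CMType K)
    (hA : IsCMTypeRealisation Φ A ι θ) : A.IsSimple ↔ IsNondegenerate Φ := by
  obtain ⟨φ₀⟩ : Nonempty (K →+* ℂ) := inferInstance
  exact ⟨isNondegenerate_of_isSimple_of_isGalois_eight hK hA,
    fun hΦ => (isSimple_iff_isPrimitive hA φ₀).2 (hΦ.isPrimitive φ₀)⟩

/-- **Galois octic CM fields: `A` simple ⟺ `Rank(Φ) = 5`** (the Kubota rank of the type is maximal).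
[cite: Dodson1984, §3.3.2 Theorem (p. 16)] [cite: Kubota1965, §4 Lemma 2] -/
theorem isSimple_iff_cmTypeRank_eq_five_of_isGalois_eight (hK : Module.finrank ℚ K = 8) (Φ : CMType K)
    (hA : IsCMTypeRealisation Φ A ι θ) : A.IsSimple ↔ cmTypeRank Φ = 5 := by
  rw [isSimple_iff_isNondegenerate_of_isGalois_eight hK Φ hA,
    _root_.Literature.AlgebraicGeometry.Pohlmann1968.isNondegenerate_iff, hK]

/-- **`Bᵐ(Aⁿ) ⊗ ℂ = Dᵐ(Aⁿ) ⊗ ℂ` FOR ALL `n, m`, FOR EVERY ABELIAN VARIETY WITH COMPLEX MULTIPLICATION BY A GALOIS OCTIC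
CM FIELD**: `K` a CM field of degree `8` Galois over `ℚ`, `Φ` any CM type, `(A, ι, θ)` any realisation — the Hodge
classes of every power of `A` are spanned by products of divisor classes (`A` simple: nondegenerate type, Hazama–Murty;
`A` not simple: the degree-`≤ 12` imprimitive theorem). [cite: Gordon1999HodgeAVSurvey, 5.13 (i) and Thm. 6.4]
[cite: Dodson1984, §3.3.2 Theorem (p. 16)] [cite: MoonenZarhin1999LowDim, Thm. 0.1] -/
theorem hodgeClassSpan_pow_eq_divisorClassesSpan_of_isGalois_eight (hK : Module.finrank ℚ K = 8) (Φ : CMType K)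
    (hA : IsCMTypeRealisation Φ A ι θ) (n m : ℕ) :
    hodgeClassSpan (⨁ fun _ : Fin n => A).dim (⨁ fun _ : Fin n => A).X m =
      divisorClassesSpan (⨁ fun _ : Fin n => A).X (⨁ fun _ : Fin n => A).dim m := by
  by_cases hs : A.IsSimple
  · exact hodgeClassSpan_pow_eq_divisorClassesSpan_of_isSimple_of_isGalois_eight hK hA hs n m
  · obtain ⟨φ₀⟩ : Nonempty (K →+* ℂ) := inferInstance
    exact hodgeClassSpan_pow_eq_divisorClassesSpan_of_not_isPrimitive_of_finrank_le_twelve (by omega) Φ φ₀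
      (fun h => hs ((isSimple_iff_isPrimitive hA φ₀).2 h)) hA n m

/-- **THE HODGE CONJECTURE FOR EVERY POWER OF EVERY ABELIAN VARIETY WITH COMPLEX MULTIPLICATION BY A GALOIS OCTIC CM
FIELD, UNCONDITIONALLY**: `K` a CM field of degree `8` Galois over `ℚ` (any of the groups `ℤ/8`, `ℤ/4 × ℤ/2`,
`(ℤ/2)³`, `D₄`, `Q₈`), `Φ` ANY CM type, `(A, ι, θ)` ANY abelian variety of type `(K; Φ)` read on `H¹`, simple or not:
`HodgeConjectureFor` holds for `Aⁿ = ⨁_{i<n} A`, every `n`. [cite: Gordon1999HodgeAVSurvey, 5.13 (i) and Thm. 6.4]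
[cite: Dodson1984, §3.3.2 Theorem (p. 16)] [cite: MoonenZarhin1999LowDim, Thm. 0.1] -/
theorem hodgeConjectureFor_pow_of_isGalois_eight (hK : Module.finrank ℚ K = 8) (Φ : CMType K)
    (hA : IsCMTypeRealisation Φ A ι θ) (n : ℕ) :
    HodgeConjectureFor (⨁ fun _ : Fin n => A).dim (⨁ fun _ : Fin n => A).X := by
  by_cases hs : A.IsSimple
  · exact hodgeConjectureFor_pow_of_isSimple_of_isGalois_eight hK hA hs n
  · exact hodgeConjectureFor_pow_of_not_isSimple_of_finrank_le_twelve (by omega) Φ hA hs n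

/-- **THE HODGE CONJECTURE FOR EVERY ABELIAN VARIETY WITH COMPLEX MULTIPLICATION BY A GALOIS OCTIC CM FIELD** (the
variety itself, spelling `HodgeConjectureFor A.dim A.X`), unconditionally. [cite: Gordon1999HodgeAVSurvey, 5.13 (i) and Thm. 6.4]
[cite: Dodson1984, §3.3.2 Theorem (p. 16)] [cite: MoonenZarhin1999LowDim, Thm. 0.1] [cite: vanGeemen1994HodgeAV, Lemma 3.7] -/
theorem hodgeConjectureFor_of_isGalois_eight (hK : Module.finrank ℚ K = 8) (Φ : CMType K)
    (hA : IsCMTypeRealisation Φ A ι θ) : HodgeConjectureFor A.dim A.X := by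
  by_cases hs : A.IsSimple
  · exact hodgeConjectureFor_of_isSimple_of_isGalois_eight hK hA hs
  · exact hodgeConjectureFor_of_not_isSimple_of_finrank_le_twelve (by omega) Φ hA hs

/-- **Every Hodge class on every power of an abelian variety with CM by a Galois octic CM field is algebraic.**
[cite: Gordon1999HodgeAVSurvey, 5.13 (i) and Thm. 6.4] [cite: Dodson1984, §3.3.2 Theorem (p. 16)] -/
theorem hodgeClasses_algebraic_pow_of_isGalois_eight (hK : Module.finrank ℚ K = 8) (Φ : CMType K)
    (hA : IsCMTypeRealisation Φ A ι θ) (n m : ℕ) (c : complexBetti (⨁ fun _ : Fin n => A).X (2 * m))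
    (hcQ : IsRationalClass c) (hcH : IsOfHodgeType (⨁ fun _ : Fin n => A).dim (⨁ fun _ : Fin n => A).X (2 * m) m m c) :
    c ∈ algebraicClasses (⨁ fun _ : Fin n => A).X m :=
  (hodgeConjectureFor_pow_of_isGalois_eight hK Φ hA n).2 m c hcQ hcH

/-- **No power of an abelian variety with CM by a Galois octic CM field carries an exceptional Hodge class.**
[cite: Gordon1999HodgeAVSurvey, 5.13 (i) and Thm. 6.4] [cite: MoonenZarhin1995Duke, Thm. 2.4] -/
theorem not_exists_exceptional_pow_of_isGalois_eight (hK : Module.finrank ℚ K = 8) (Φ : CMType K)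
    (hA : IsCMTypeRealisation Φ A ι θ) (n m : ℕ) :
    ¬ ∃ c : complexBetti (⨁ fun _ : Fin n => A).X (2 * m), IsRationalClass c ∧
        IsOfHodgeType (⨁ fun _ : Fin n => A).dim (⨁ fun _ : Fin n => A).X (2 * m) m m c ∧
        c ∉ divisorClassesSpan (⨁ fun _ : Fin n => A).X (⨁ fun _ : Fin n => A).dim m := by
  rintro ⟨c, hcQ, hcH, hcD⟩
  exact hcD ((hodgeClassSpan_pow_eq_divisorClassesSpan_of_isGalois_eight hK Φ hA n m) ▸
    Submodule.subset_span ⟨hcQ, hcH⟩)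

end GaloisOctic

/-! ## §2 The cyclotomic octic CM fields `ℚ(ζ₁₅)`, `ℚ(ζ₁₆)`, `ℚ(ζ₂₀)`, `ℚ(ζ₂₄)` -/

section Cyclotomic

omit [IsCMField K] in
/-- The Hodge conjecture for every power of every abelian variety of CM type `(ℚ(ζₙ), Φ)` when `φ(n) = 8`
(`ℚ(ζₙ)` is a CM field Galois over `ℚ` of degree `8`). [cite: Gordon1999HodgeAVSurvey, 5.13 (i) and Thm. 6.4]
[cite: Dodson1984, §3.3.2 Theorem (p. 16)] -/
private theorem hodgeConjectureFor_pow_of_isCyclotomicExtension {n : ℕ} [NeZero n] [IsCyclotomicExtension {n} ℚ K]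
    (h2n : 2 < n) (htot : n.totient = 8) (Φ : CMType K) (hA : IsCMTypeRealisation Φ A ι θ) (r : ℕ) :
    HodgeConjectureFor (⨁ fun _ : Fin r => A).dim (⨁ fun _ : Fin r => A).X := by
  haveI := IsCyclotomicExtension.isGalois {n} ℚ K
  haveI := IsCyclotomicExtension.Rat.isCMField K (S := {n}) ⟨n, rfl, h2n⟩
  have h8 : Module.finrank ℚ K = 8 := by
    rw [IsCyclotomicExtension.finrank K (Polynomial.cyclotomic.irreducible_rat (NeZero.pos n)), htot]
  exact hodgeConjectureFor_pow_of_isGalois_eight h8 Φ hA r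

omit [IsCMField K] in
/-- **`ℚ(ζ₁₅)`**: the Hodge conjecture for every power of every abelian variety of CM type `(ℚ(ζ₁₅), Φ)`, every `Φ`.
[cite: Gordon1999HodgeAVSurvey, 5.13 (i) and Thm. 6.4] [cite: Dodson1984, §3.3.2 Theorem (p. 16)] -/
theorem hodgeConjectureFor_pow_of_isCyclotomicExtension_fifteen [IsCyclotomicExtension {15} ℚ K] (Φ : CMType K)
    (hA : IsCMTypeRealisation Φ A ι θ) (r : ℕ) :
    HodgeConjectureFor (⨁ fun _ : Fin r => A).dim (⨁ fun _ : Fin r => A).X :=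
  hodgeConjectureFor_pow_of_isCyclotomicExtension (n := 15) (by norm_num) (by decide) Φ hA r

omit [IsCMField K] in
/-- **`ℚ(ζ₁₆)`**: the Hodge conjecture for every power of every abelian variety of CM type `(ℚ(ζ₁₆), Φ)`, every `Φ`.
[cite: Gordon1999HodgeAVSurvey, 5.13 (i) and Thm. 6.4] [cite: Dodson1984, §3.3.2 Theorem (p. 16)] -/
theorem hodgeConjectureFor_pow_of_isCyclotomicExtension_sixteen [IsCyclotomicExtension {16} ℚ K] (Φ : CMType K)
    (hA : IsCMTypeRealisation Φ A ι θ) (r : ℕ) :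
    HodgeConjectureFor (⨁ fun _ : Fin r => A).dim (⨁ fun _ : Fin r => A).X :=
  hodgeConjectureFor_pow_of_isCyclotomicExtension (n := 16) (by norm_num) (by decide) Φ hA r

omit [IsCMField K] in
/-- **`ℚ(ζ₂₀)`**: the Hodge conjecture for every power of every abelian variety of CM type `(ℚ(ζ₂₀), Φ)`, every `Φ`.
[cite: Gordon1999HodgeAVSurvey, 5.13 (i) and Thm. 6.4] [cite: Dodson1984, §3.3.2 Theorem (p. 16)] -/
theorem hodgeConjectureFor_pow_of_isCyclotomicExtension_twenty [IsCyclotomicExtension {20} ℚ K] (Φ : CMType K)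
    (hA : IsCMTypeRealisation Φ A ι θ) (r : ℕ) :
    HodgeConjectureFor (⨁ fun _ : Fin r => A).dim (⨁ fun _ : Fin r => A).X :=
  hodgeConjectureFor_pow_of_isCyclotomicExtension (n := 20) (by norm_num) (by decide) Φ hA r

omit [IsCMField K] in
/-- **`ℚ(ζ₂₄)`**: the Hodge conjecture for every power of every abelian variety of CM type `(ℚ(ζ₂₄), Φ)`, every `Φ`.
[cite: Gordon1999HodgeAVSurvey, 5.13 (i) and Thm. 6.4] [cite: Dodson1984, §3.3.2 Theorem (p. 16)] -/
theorem hodgeConjectureFor_pow_of_isCyclotomicExtension_twentyFour [IsCyclotomicExtension {24} ℚ K] (Φ : CMType K)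
    (hA : IsCMTypeRealisation Φ A ι θ) (r : ℕ) :
    HodgeConjectureFor (⨁ fun _ : Fin r => A).dim (⨁ fun _ : Fin r => A).X :=
  hodgeConjectureFor_pow_of_isCyclotomicExtension (n := 24) (by norm_num) (by decide) Φ hA r

end Cyclotomic

/-! ## §3 Addendum: multiquadratic CM fields of any degree `≥ 8` — rank-`2` types are never simple -/

namespace Multiquadratic

omit [IsCMField K] in
/-- **`Φg = Φ` for some `g ≠ 1` in `Aut(K)` ⟹ `Φ` is NOT primitive**: the embeddings `φ₀ ∘ g ≠ φ₀` have the same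
pattern `τ ↦ [τ ∘ s ∈ Φ]` under `Aut(ℂ)` (Shimura's criterion, tree `isPrimitive_ringEquiv_complex_iff`).
[cite: Shimura1998, §8.2 Prop. 26] -/
theorem not_isPrimitive_of_comp_mem_iff (Φ : CMType K) (φ₀ : K →+* ℂ) {g : K ≃ₐ[ℚ] K} (hg1 : g ≠ 1)
    (hstab : ∀ φ : K →+* ℂ, φ.comp (g : K →+* K) ∈ Φ.1 ↔ φ ∈ Φ.1) : ¬ IsPrimitive (ℂ ≃+* ℂ) Φ.1 φ₀ := by
  rw [isPrimitive_ringEquiv_complex_iff]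
  intro h
  have key : φ₀.comp (g : K →+* K) = φ₀ := h _ _ fun τ => by
    rw [← RingHom.comp_assoc]
    exact hstab _
  refine hg1 (AlgEquiv.ext fun x => ?_)
  have hx := RingHom.congr_fun key x
  rw [RingHom.comp_apply] at hx
  rw [AlgEquiv.one_apply]
  exact φ₀.injective hx

/-- **Rank-`2` CM types of a multiquadratic CM field of degree `≥ 8` are NOT primitive** (they are induced from an
imaginary quadratic subfield: the tree's `exists_ne_one_stabilizer_of_cmTypeRank_eq_two` gives `g ≠ 1` with `Φg = Φ`).
[cite: Kubota1965, §4 Lemma 2] [cite: Shimura1998, §8.2 Prop. 26] [cite: Dodson1984, §3.1.1 Theorem] -/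
theorem not_isPrimitive_of_cmTypeRank_eq_two [IsGalois ℚ K] (hexp : ∀ g : K ≃ₐ[ℚ] K, g ^ 2 = 1)
    (h8 : 8 ≤ Module.finrank ℚ K) (Φ : CMType K) (φ₀ : K →+* ℂ) (hr : cmTypeRank Φ = 2) :
    ¬ IsPrimitive (ℂ ≃+* ℂ) Φ.1 φ₀ := by
  obtain ⟨g, hg1, hstab⟩ := exists_ne_one_stabilizer_of_cmTypeRank_eq_two hexp h8 Φ hr
  exact not_isPrimitive_of_comp_mem_iff Φ φ₀ hg1 hstab

/-- **The abelian varieties of a rank-`2` CM type of a multiquadratic CM field of degree `≥ 8` are NOT simple**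
(simple ⟺ primitive, tree `isSimple_iff_isPrimitive`). [cite: Shimura1998, §8.2 Prop. 26] [cite: Dodson1984, §3.1.1 Theorem] -/
theorem not_isSimple_of_cmTypeRank_eq_two [IsGalois ℚ K] (hexp : ∀ g : K ≃ₐ[ℚ] K, g ^ 2 = 1)
    (h8 : 8 ≤ Module.finrank ℚ K) (Φ : CMType K) (hA : IsCMTypeRealisation Φ A ι θ) (hr : cmTypeRank Φ = 2) :
    ¬ A.IsSimple := by
  obtain ⟨φ₀⟩ : Nonempty (K →+* ℂ) := inferInstance
  rw [isSimple_iff_isPrimitive hA φ₀]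
  exact not_isPrimitive_of_cmTypeRank_eq_two hexp h8 Φ φ₀ hr

end Multiquadratic

end Literature.AlgebraicGeometry.Pohlmann1968
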